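import Literature.Combinatorics.SimpleGraph.HamiltonianPathEnumeration
import HarnessLib

/-!
# Grid cells for Hamiltonian-path counting reductions: a one-bit cell and a native PARITY cell

Support for the gadget reduction `#3SAT ≤ #HamPath` on subgraphs of the two-dimensional grid
(Liśkiewicz–Ogihara–Toda 2003, §3–§4, Lemma 4 and Theorem 7; tree fact
`Literature.Barriers.CriticalPhenomena.GridSAW.LOT2003_lemma4_gadgets`). The printed reduction draws the
Garey–Johnson–Tarjan gadget graph and resolves crossings of XOR-lines by the "crossing XOR-gadgets" of
[GJT76]; for a formal proof we assemble the base graph ("skeleton") of the substitution method of the tree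
(`HamiltonianGadgetSubstitution*.lean`, `HamiltonianIteratedSubstitution.lean`) from **cells that are
themselves subgraphs of the `4 × 4` grid**, so that the final instance is drawn on `ℤ²` by translation.
A cell is entered at a corner `P` and left at a corner `Q` (cut vertices of the chain of cells); its
**traversals** are its Hamiltonian `P`–`Q` paths, and a boundary edge ("slot") is read by which
traversals use it. This file provides three cell types, found by exhaustive computer search over
subgraphs of small grid blocks, and certifies their traversals by the verified enumerator
`hamPathsList` of `HamiltonianPathEnumeration.lean` (kernel computation, as in `TutteFragment.lean`):

* `GridCell.CellTy.bead` — the `4 × 3` block minus the edge `(1,1)–(2,1)`, `P = (0,0)`, `Q = (3,0)`: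
  exactly TWO traversals (`travs_bead`); a one-bit cell whose bit is readable on the bottom side
  (edges `(0,0)–(1,0)`, `(1,0)–(2,0)`, `(2,0)–(3,0)`) and on the other side (`(0,0)–(0,1)`,
  `(1,2)–(2,2)`, `(3,0)–(3,1)`), with the usages listed in `usage_bead`.
* `GridCell.CellTy.pc` — the `4 × 4` block minus `(1,1)–(2,1)`, `(0,2)–(1,2)`, `(2,2)–(3,2)`,
  `P = (0,0)`, `Q = (3,0)`: exactly FOUR traversals (`travs_pc`), and the usages of the slots
  `(0,0)–(1,0)` (`a`), `(2,0)–(3,0)` (`b`) and `(1,3)–(2,3)` are `a`, `b`, `a XOR b`: a **parity cell**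
  (a two-bit cell exposing `a` on its west end, `b` on its east end and `a XOR b` on its top side),
  which replaces the non-planar clause expansion of an XOR gate; three of them make a planar
  crossover of two wires (used for the grid layout in the sequel files).
* `GridCell.CellTy.pct` — the reflection of `pc` in a horizontal line (`P = (0,3)`, `Q = (3,3)`, the
  parity slot `(1,0)–(2,0)` on the bottom side).

Vertices of a cell are `Fin 16`, vertex `4y + x` standing for the grid point `(x, y)`; `bead` uses
only `y < 3`. Everything here is decided by computation; the geometric reading (grid points, unit
edges, degrees ≤ 3, `P`, `Q` of cell-degree 2) is recorded in `GridCell.CellTy.coord`, `edges_unit`,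
`degree_le_three`, `degree_pq`.

## References

* M. Liśkiewicz, M. Ogihara, S. Toda, TCS 304 (2003) 129–156, §3 (Lemma 4), §4 (Theorem 7).
* M. R. Garey, D. S. Johnson, R. E. Tarjan, SIAM J. Comput. 5 (1976) 704–714 (XOR-lines and their
  crossings).
* M. R. Garey, D. S. Johnson, *Computers and Intractability*, Freeman 1979, §3.2.2 (local replacement).
-/

namespace Literature.Combinatorics.SimpleGraph

namespace GridCell

/-- The three cell types: the one-bit cell, the parity cell, and its reflection. [folklore] -/
inductive CellTy
  | bead
  | pc
  | pct
  deriving DecidableEq, Repr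

namespace CellTy

/-- The edges of a cell, as pairs of local vertices `4y + x` (each undirected edge listed once).
Found by computer search (see the module docstring). [folklore] -/
def edgeList : CellTy → List (Fin 16 × Fin 16)
  | bead => [(0, 1), (0, 4), (1, 2), (1, 5), (2, 3), (2, 6), (3, 7), (4, 5), (4, 8), (5, 9), (6, 7), (6, 10), (7, 11), (8, 9), (9, 10), (10, 11)]
  | pc => [(0, 1), (0, 4), (1, 2), (1, 5), (2, 3), (2, 6), (3, 7), (4, 5), (4, 8), (5, 9), (6, 7), (6, 10), (7, 11), (8, 12), (9, 10), (9, 13), (10, 14), (11, 15), (12, 13), (13, 14), (14, 15)]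
  | pct => [(0, 1), (0, 4), (1, 2), (1, 5), (2, 3), (2, 6), (3, 7), (4, 8), (5, 6), (5, 9), (6, 10), (7, 11), (8, 9), (8, 12), (9, 13), (10, 11), (10, 14), (11, 15), (12, 13), (13, 14), (14, 15)]

/-- The local vertices of a cell (`bead` has the twelve vertices `y < 3`). [folklore] -/
def vertList : CellTy → List (Fin 16)
  | bead => (List.finRange 16).filter fun j => j.val < 12
  | _ => List.finRange 16

/-- The entry corner `P`. [folklore] -/
def pIdx : CellTy → Fin 16
  | bead => 0
  | pc => 0
  | pct => 12

/-- The exit corner `Q`. [folklore] -/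
def qIdx : CellTy → Fin 16
  | bead => 3
  | pc => 3
  | pct => 15

/-- Boolean adjacency of a cell: the edge list read in both directions. [folklore] -/
def adjB (ty : CellTy) (a b : Fin 16) : Bool :=
  decide ((a, b) ∈ ty.edgeList) || decide ((b, a) ∈ ty.edgeList)

/-- Adjacency is symmetric (by `decide`). [folklore] -/
theorem adjB_symm (ty : CellTy) (a b : Fin 16) : ty.adjB a b = ty.adjB b a := by
  revert a b; cases ty <;> decide

/-- Adjacency is irreflexive (by `decide`). [folklore] -/
theorem adjB_irrefl (ty : CellTy) (a : Fin 16) : ty.adjB a a = false := by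
  revert a; cases ty <;> decide

/-- **The graph of a cell** on the local vertices `Fin 16`. [folklore] -/
def graph (ty : CellTy) : _root_.SimpleGraph (Fin 16) :=
  _root_.SimpleGraph.fromRel fun a b => ty.adjB a b = true

/-- Adjacency of the cell graph is the Boolean adjacency. [folklore] -/
theorem graph_adj (ty : CellTy) (a b : Fin 16) : ty.graph.Adj a b ↔ ty.adjB a b = true := by
  rw [graph, _root_.SimpleGraph.fromRel_adj]
  constructor
  · rintro ⟨-, h | h⟩
    · exact h
    · rwa [adjB_symm]
  · intro h
    refine ⟨?_, Or.inl h⟩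
    rintro rfl
    rw [adjB_irrefl] at h
    exact Bool.false_ne_true h

/-- Adjacency of the cell graph is decidable. [folklore] -/
instance (ty : CellTy) : DecidableRel ty.graph.Adj := fun a b =>
  decidable_of_iff _ (ty.graph_adj a b).symm

/-- The vertex set of a cell. [folklore] -/
def verts (ty : CellTy) : Finset (Fin 16) := ty.vertList.toFinset

/-- The vertex list has no repeats. [folklore] -/
theorem vertList_nodup (ty : CellTy) : ty.vertList.Nodup := by
  cases ty <;> decide

/-- Edges join listed vertices (the graph lives on `verts`). [folklore] -/
theorem mem_vertList_of_adjB (ty : CellTy) : ∀ a b, ty.adjB a b = true → a ∈ ty.vertList ∧ b ∈ ty.vertList := by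
  cases ty <;> decide

/-- **The traversals of a cell**: its Hamiltonian `P`–`Q` vertex lists, by the verified enumerator.
[folklore] -/
def travs (ty : CellTy) : List (List (Fin 16)) :=
  hamPathsList ty.adjB ty.vertList ty.pIdx ty.qIdx

/-- **Traversals are exactly the Hamiltonian `P`–`Q` paths of the cell.** [folklore] -/
theorem isHamPathOn_iff_mem_travs (ty : CellTy) (l : List (Fin 16)) :
    IsHamPathOn ty.graph ty.verts ty.pIdx ty.qIdx l ↔ l ∈ ty.travs :=
  isHamPathOn_iff_mem_hamPathsList ty.graph ty.adjB ty.vertList ty.vertList_nodup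
    (fun a _ b _ => ty.graph_adj a b)

/-- The traversal list has no repeats. [folklore] -/
theorem travs_nodup (ty : CellTy) : ty.travs.Nodup :=
  nodup_hamPathsList _ _ ty.vertList_nodup _ _

/-- **The one-bit cell has exactly two traversals** (kernel computation). [folklore] -/
theorem travs_bead : bead.travs =
    [[0, 1, 5, 4, 8, 9, 10, 11, 7, 6, 2, 3],
    [0, 4, 8, 9, 5, 1, 2, 6, 10, 11, 7, 3]] := by
  decide +kernel

/-- **The parity cell has exactly four traversals** (kernel computation). [folklore] -/
theorem travs_pc : pc.travs =
    [[0, 1, 2, 6, 10, 9, 5, 4, 8, 12, 13, 14, 15, 11, 7, 3],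
    [0, 1, 5, 4, 8, 12, 13, 9, 10, 14, 15, 11, 7, 6, 2, 3],
    [0, 4, 8, 12, 13, 9, 5, 1, 2, 6, 10, 14, 15, 11, 7, 3],
    [0, 4, 8, 12, 13, 14, 15, 11, 7, 6, 10, 9, 5, 1, 2, 3]] := by
  decide +kernel

/-- **The reflected parity cell has exactly four traversals** (kernel computation). [folklore] -/
theorem travs_pct : pct.travs =
    [[12, 8, 4, 0, 1, 2, 3, 7, 11, 10, 6, 5, 9, 13, 14, 15],
    [12, 8, 4, 0, 1, 5, 9, 13, 14, 10, 6, 2, 3, 7, 11, 15],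
    [12, 13, 9, 8, 4, 0, 1, 5, 6, 2, 3, 7, 11, 10, 14, 15],
    [12, 13, 14, 10, 6, 5, 9, 8, 4, 0, 1, 2, 3, 7, 11, 15]] := by
  decide +kernel

/-- The number of traversals of each cell type: `2, 4, 4`. [folklore] -/
def ntrav : CellTy → ℕ
  | bead => 2
  | pc => 4
  | pct => 4

/-- The traversal list has `ntrav` members. [folklore] -/
theorem length_travs (ty : CellTy) : ty.travs.length = ty.ntrav := by
  cases ty
  · rw [travs_bead]; rfl
  · rw [travs_pc]; rfl
  · rw [travs_pct]; rfl

/-- The `k`-th traversal. [folklore] -/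
def trav (ty : CellTy) (k : Fin ty.ntrav) : List (Fin 16) :=
  ty.travs.get (k.cast ty.length_travs.symm)

/-- Every traversal is some `trav k`. [folklore] -/
theorem mem_travs_iff (ty : CellTy) (l : List (Fin 16)) : l ∈ ty.travs ↔ ∃ k, ty.trav k = l := by
  rw [List.mem_iff_get]
  constructor
  · rintro ⟨i, rfl⟩
    exact ⟨i.cast ty.length_travs, by simp [trav]⟩
  · rintro ⟨k, rfl⟩
    exact ⟨_, rfl⟩

/-- `trav` is injective (the traversal list has no repeats). [folklore] -/
theorem trav_injective (ty : CellTy) : Function.Injective ty.trav := by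
  intro k k' h
  have := (List.nodup_iff_injective_get.1 ty.travs_nodup) h
  simpa [Fin.ext_iff] using this

/-- **Hamiltonian `P`–`Q` paths of a cell are exactly the `trav k`.** [folklore] -/
theorem isHamPathOn_iff_exists_trav (ty : CellTy) (l : List (Fin 16)) :
    IsHamPathOn ty.graph ty.verts ty.pIdx ty.qIdx l ↔ ∃ k, ty.trav k = l := by
  rw [isHamPathOn_iff_mem_travs, mem_travs_iff]

/-! ### Slots and their usage by the traversals -/

/-- Boolean test: the vertex list `l` uses the edge `e` (the two ends are consecutive in `l`, in
either order). [folklore] -/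
def usesB (l : List (Fin 16)) (e : Fin 16 × Fin 16) : Bool :=
  decide ([e.1, e.2] <:+: l) || decide ([e.2, e.1] <:+: l)

/-- `usesB` decides `Uses`. [folklore] -/
theorem usesB_eq_true_iff (l : List (Fin 16)) (e : Fin 16 × Fin 16) : usesB l e = true ↔ Uses l e := by
  simp [usesB, Uses]

/-- **Usage of the edge `e` by the `k`-th traversal**, as a Boolean. [folklore] -/
def usage (ty : CellTy) (e : Fin 16 × Fin 16) (k : Fin ty.ntrav) : Bool :=
  usesB (ty.trav k) e

/-- `usage` decides `Uses (trav k) e`. [folklore] -/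
theorem usage_eq_true_iff (ty : CellTy) (e : Fin 16 × Fin 16) (k : Fin ty.ntrav) :
    ty.usage e k = true ↔ Uses (ty.trav k) e :=
  usesB_eq_true_iff _ _

/-- **Slots of the one-bit cell** (traversal `0` = the bit is `true`): bottom `(0,1)`: `k = 0`;
`(1,2)`: `k = 1`; `(2,3)`: `k = 0`; west `(0,4)`: `k = 1`; top `(9,10)`: `k = 0`; east `(3,7)`: `k = 1`
(kernel computation). [folklore] -/
theorem usage_bead (k : Fin 2) :
    bead.usage (0, 1) k = (k == 0) ∧ bead.usage (1, 2) k = (k == 1) ∧ bead.usage (2, 3) k = (k == 0) ∧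
    bead.usage (0, 4) k = (k == 1) ∧ bead.usage (9, 10) k = (k == 0) ∧ bead.usage (3, 7) k = (k == 1) := by
  revert k; decide

/-- **Slots of the parity cell**, traversal `k ∈ Fin 4` read as the bits `a = (k < 2)`, `b = k odd`:
bottom west `(0,1)`: `a`; bottom east `(2,3)`: `b`; top `(13,14)`: `a XOR b`; west `(0,4)`: `¬a`;
east `(3,7)`: `¬b` (kernel computation). [folklore] -/
theorem usage_pc (k : Fin 4) :
    pc.usage (0, 1) k = decide (k.val < 2) ∧ pc.usage (2, 3) k = decide (k.val % 2 = 1) ∧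
    pc.usage (13, 14) k = (decide (k.val < 2) != decide (k.val % 2 = 1)) ∧
    pc.usage (0, 4) k = !decide (k.val < 2) ∧ pc.usage (3, 7) k = !decide (k.val % 2 = 1) := by
  revert k; decide

/-- **Slots of the reflected parity cell**, bits `a = (k < 2)`, `b = k odd`: west `(8,12)`: `a`;
east `(11,15)`: `b`; bottom `(1,2)`: `a XOR b`; top west `(12,13)`: `¬a`; top east `(14,15)`: `¬b`
(kernel computation). [folklore] -/
theorem usage_pct (k : Fin 4) :
    pct.usage (8, 12) k = decide (k.val < 2) ∧ pct.usage (11, 15) k = decide (k.val % 2 = 1) ∧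
    pct.usage (1, 2) k = (decide (k.val < 2) != decide (k.val % 2 = 1)) ∧
    pct.usage (12, 13) k = !decide (k.val < 2) ∧ pct.usage (14, 15) k = !decide (k.val % 2 = 1) := by
  revert k; decide

/-! ### Geometry of the cells -/

/-- The grid point of a local vertex: `4y + x ↦ (x, y)`. [folklore] -/
def coord (j : Fin 16) : ℤ × ℤ := ((j.val % 4 : ℕ), (j.val / 4 : ℕ))

set_option maxRecDepth 4000 in
/-- **Every edge of a cell is a unit edge of the grid** (the two grid points differ by one in one
coordinate). [folklore] -/
theorem edges_unit (ty : CellTy) : ∀ e ∈ ty.edgeList,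
    (coord e.1).1 = (coord e.2).1 ∧ (coord e.2).2 = (coord e.1).2 + 1 ∨
    (coord e.1).2 = (coord e.2).2 ∧ (coord e.2).1 = (coord e.1).1 + 1 := by
  cases ty <;> decide

/-- The cell-degree of a local vertex (number of incident cell edges). [folklore] -/
def degree (ty : CellTy) (j : Fin 16) : ℕ :=
  (ty.edgeList.filter fun e => e.1 = j ∨ e.2 = j).length

/-- **Maximum degree three** inside every cell. [folklore] -/
theorem degree_le_three (ty : CellTy) : ∀ j, ty.degree j ≤ 3 := by
  cases ty <;> decide

/-- **The corners `P`, `Q` have cell-degree two** (the chain edge is their third edge). [folklore] -/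
theorem degree_pq (ty : CellTy) : ty.degree ty.pIdx = 2 ∧ ty.degree ty.qIdx = 2 := by
  cases ty <;> decide

/-- `P ≠ Q`. [folklore] -/
theorem pIdx_ne_qIdx (ty : CellTy) : ty.pIdx ≠ ty.qIdx := by
  cases ty <;> decide

/-- `P` and `Q` are vertices of the cell. [folklore] -/
theorem pIdx_mem (ty : CellTy) : ty.pIdx ∈ ty.vertList ∧ ty.qIdx ∈ ty.vertList := by
  cases ty <;> decide

end CellTy

end GridCell

end Literature.Combinatorics.SimpleGraph
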